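import Mathlib.Analysis.SpecialFunctions.Log.Deriv
import Mathlib.Analysis.SpecialFunctions.Pow.Deriv
import Mathlib.Analysis.Calculus.IteratedDeriv.Lemmas
import Mathlib.Analysis.Normed.Group.Bounded
import Literature.Analysis.FluidPDE.CompressibleEulerExactSelfSimilarImplosion
import HarnessLib

/-!
# Decay of all derivatives of the self-similar profile at infinity (theorems only)

Topic `Literature/Analysis/FluidPDE`; namespace `Literature.Analysis.FluidPDE.CaolaboraEtAl2025`.
Companion of `CompressibleEulerExactSelfSimilarImplosion.lean` (§Decay there: the end-point
condition `U/ζ, S/ζ → 0` of the vendored profile fact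
`BuckmasterCaolaboraGomezserrano2025_thm11_monatomic` forces `U′, S′ → 0` and `U, S` bounded).
THEOREMS ONLY, no new facts (D-0026).

Cao-Labora–Gómez-Serrano–Shi–Staffilani record, for the profiles they use, the far-field bounds
`|∇ʲŪ| + |∇ʲS̄| ≲ ⟨ζ⟩^{1−r−j}` for all `j` (eq. (1.6), p. 6 of the held text
`paper-arxiv-2310.05325`), a consequence of the analysis of the point at infinity `P_∞` of the
autonomous phase portrait of Buckmaster–Cao-Labora–Gómez-Serrano (§2). This file proves the
weaker, `r`-independent form that already follows from the HYPOTHESES of the vendored fact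
(smooth radial fields, the radial profile ODEs for `ζ > 0`, `U/ζ, S/ζ → 0`):

  for every `k`:  `|U^{(k)}(ζ)| + |S^{(k)}(ζ)| ≤ C_k ζ^{1−k}` for `ζ ≥ ζ_k`

(`iteratedDeriv_profile_le`), which is what the polynomial-in-`(T−t)⁻¹` bounds on the higher
derivatives of the exact self-similar solution require. The proof is the one behind (1.6):

* in the logarithmic variable `ξ = log ζ` the rescaled unknowns `𝒰(ξ) = U(e^ξ)/e^ξ`,
  `𝒮(ξ) = S(e^ξ)/e^ξ` solve an AUTONOMOUS rational system `(𝒰, 𝒮)′ = W(𝒰, 𝒮)`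
  (`hasDerivAt_logProfile`, `logVar_solve`), smooth near the equilibrium `P_∞ = (0, 0)` to which
  the orbit converges;
* along an orbit of an autonomous `C^∞` system that stays in a compact part of the domain, every
  iterated derivative is a fixed smooth function of the position (`D^{k+1} = ∂(D^k)·W`), hence
  bounded (`exists_contDiffOn_iteratedDeriv_eq`, `exists_bound_iteratedDeriv_of_flow`);
* back in `ζ`: `U(ζ) = ζ 𝒰(log ζ)` gives `U^{(k)}(ζ) = ζ^{1−k} h_k(log ζ)` with
  `h₀ = 𝒰`, `h_{k+1} = h_k′ + (1−k) h_k`, all bounded (`iteratedDeriv_le_rpow_of_log`).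

[cite: CaolaboraEtAl2025, eq. (1.6) p. 6 (weaker exponent `1 − k`)]
[cite: BuckmasterCaolaboraGomezserrano2025, Thm 1.1 p. 4 (`P_∞`, smooth self-similar profiles)]
-/

noncomputable section

open Set Filter Topology
open scoped ContDiff

namespace Literature.Analysis.FluidPDE

open Literature.MathematicalPhysics.KineticTheory (V3)

namespace CaolaboraEtAl2025

/-! ### Iterated derivatives along the orbit of an autonomous system -/

section Flow

variable {F : Type*} [NormedAddCommGroup F] [NormedSpace ℝ F]

/-- Along a solution `y′ = W(y)` of an autonomous `C^∞` system on an open set `O`, every iterated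
derivative is a smooth function of the position: `y^{(k)}(ξ) = Φ_k(y(ξ))` with `Φ₀ = id`,
`Φ_{k+1} = ∂Φ_k · W`. [folklore] -/
theorem exists_contDiffOn_iteratedDeriv_eq {W : F → F} {O : Set F} (hO : IsOpen O)
    (hW : ContDiffOn ℝ ∞ W O) {y : ℝ → F} {a : ℝ}
    (hy : ∀ ξ, a < ξ → HasDerivAt y (W (y ξ)) ξ) (hyO : ∀ ξ, a < ξ → y ξ ∈ O) :
    ∀ k : ℕ, ∃ Φ : F → F, ContDiffOn ℝ ∞ Φ O ∧ ∀ ξ, a < ξ → iteratedDeriv k y ξ = Φ (y ξ)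
  | 0 => ⟨id, contDiffOn_id, fun ξ _ => by simp⟩
  | k + 1 => by
    obtain ⟨Φ, hΦ, hk⟩ := exists_contDiffOn_iteratedDeriv_eq hO hW hy hyO k
    refine ⟨fun p => fderiv ℝ Φ p (W p),
      (hΦ.fderiv_of_isOpen hO (by exact (rfl : (∞ : ℕ∞ω) + 1 = ∞).le)).clm_apply hW,
      fun ξ hξ => ?_⟩
    have heq : iteratedDeriv k y =ᶠ[𝓝 ξ] fun η => Φ (y η) := by
      filter_upwards [Ioi_mem_nhds hξ] with η hη
      exact hk η hη
    have h1 : HasFDerivAt Φ (fderiv ℝ Φ (y ξ)) (y ξ) :=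
      ((hΦ.differentiableOn (by simp)).differentiableAt (hO.mem_nhds (hyO ξ hξ))).hasFDerivAt
    have h2 : HasDerivAt (fun η => Φ (y η)) (fderiv ℝ Φ (y ξ) (W (y ξ))) ξ :=
      h1.comp_hasDerivAt ξ (hy ξ hξ)
    rw [iteratedDeriv_succ, heq.deriv_eq, h2.deriv]

/-- **All derivatives are bounded along an orbit with compact closure in the domain.** If
`y′ = W(y)` for `ξ > a` with `W` smooth on an open `O` and `y(ξ) ∈ K` compact, `K ⊆ O`, then
each `y^{(k)}` is bounded on `(a, ∞)`. [folklore] -/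
theorem exists_bound_iteratedDeriv_of_flow {W : F → F} {O K : Set F} (hO : IsOpen O)
    (hW : ContDiffOn ℝ ∞ W O) (hK : IsCompact K) (hKO : K ⊆ O) {y : ℝ → F} {a : ℝ}
    (hy : ∀ ξ, a < ξ → HasDerivAt y (W (y ξ)) ξ) (hyK : ∀ ξ, a < ξ → y ξ ∈ K) (k : ℕ) :
    ∃ C, ∀ ξ, a < ξ → ‖iteratedDeriv k y ξ‖ ≤ C := by
  obtain ⟨Φ, hΦ, hk⟩ :=
    exists_contDiffOn_iteratedDeriv_eq hO hW hy (fun η hη => hKO (hyK η hη)) k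
  obtain ⟨C, hC⟩ := hK.exists_bound_of_continuousOn (hΦ.continuousOn.mono hKO)
  exact ⟨C, fun ξ hξ => by rw [hk ξ hξ]; exact hC _ (hyK ξ hξ)⟩

/-- Iterated derivatives of a pair of smooth real functions are computed componentwise.
[folklore] -/
theorem iteratedDeriv_prodMk {f g : ℝ → ℝ} (hf : ContDiff ℝ ∞ f) (hg : ContDiff ℝ ∞ g) :
    ∀ k : ℕ, iteratedDeriv k (fun ξ => (f ξ, g ξ)) =
      fun ξ => (iteratedDeriv k f ξ, iteratedDeriv k g ξ)
  | 0 => by simp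
  | k + 1 => by
    funext ξ
    simp only [iteratedDeriv_succ]
    rw [iteratedDeriv_prodMk hf hg k]
    have h1 := (hf.differentiable_iteratedDeriv k (WithTop.coe_lt_coe.2 (ENat.coe_lt_top k)) ξ)
      |>.hasDerivAt
    have h2 := (hg.differentiable_iteratedDeriv k (WithTop.coe_lt_coe.2 (ENat.coe_lt_top k)) ξ)
      |>.hasDerivAt
    exact (h1.prodMk h2).deriv

end Flow

/-! ### The logarithmic variable -/

section LogVar

/-- `ξ ↦ e^{−ξ} Φ(e^ξ)` is smooth when `Φ` is smooth on `(0, ∞)`. [folklore] -/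
theorem contDiff_logProfile {Φ : ℝ → ℝ} (hΦ : ∀ ζ : ℝ, 0 < ζ → ContDiffAt ℝ ∞ Φ ζ) :
    ContDiff ℝ ∞ fun ξ => Real.exp (-ξ) * Φ (Real.exp ξ) :=
  contDiff_iff_contDiffAt.2 fun ξ =>
    (Real.contDiff_exp.comp contDiff_neg).contDiffAt.mul
      ((hΦ _ (Real.exp_pos ξ)).comp ξ Real.contDiff_exp.contDiffAt)

/-- `(e^{−ξ} Φ(e^ξ))′ = −e^{−ξ}Φ(e^ξ) + Φ′(e^ξ)`. [folklore] -/
theorem hasDerivAt_logProfile {Φ : ℝ → ℝ} (hΦ : ∀ ζ : ℝ, 0 < ζ → ContDiffAt ℝ ∞ Φ ζ) (ξ : ℝ) :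
    HasDerivAt (fun ξ => Real.exp (-ξ) * Φ (Real.exp ξ))
      (-(Real.exp (-ξ) * Φ (Real.exp ξ)) + deriv Φ (Real.exp ξ)) ξ := by
  have h1 : HasDerivAt (fun ξ => Real.exp (-ξ)) (-Real.exp (-ξ)) ξ := by
    simpa using (hasDerivAt_neg ξ).exp
  have h2 : HasDerivAt (fun ξ => Φ (Real.exp ξ)) (deriv Φ (Real.exp ξ) * Real.exp ξ) ξ :=
    (((hΦ _ (Real.exp_pos ξ)).differentiableAt (by simp)).hasDerivAt).comp ξ
      (Real.hasDerivAt_exp ξ)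
  have h3 : HasDerivAt (fun ξ => Real.exp (-ξ) * Φ (Real.exp ξ))
      (-Real.exp (-ξ) * Φ (Real.exp ξ) + Real.exp (-ξ) * (deriv Φ (Real.exp ξ) * Real.exp ξ)) ξ :=
    h1.mul h2
  refine h3.congr_deriv ?_
  rw [Real.exp_neg]
  field_simp

/-- **Cramer's rule for the profile system in the logarithmic variable.** Dividing the radial
profile equations at `ζ = e^ξ` by `ζ` (`U = ζu`, `S = ζs`, `U′ = u + p`, `S′ = s + q`, where
`p = 𝒰′`, `q = 𝒮′`) gives the linear system `(1+u)p + (s/3)q = f`, `(s/3)p + (1+u)q = g` with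
`f = −(r−1)u − (1+u)u − s²/3`, `g = −(r−1)s − (1+u)s − su`; when its determinant
`(1+u)² − (s/3)²` does not vanish, `(p, q)` is the displayed rational function of `(u, s)`.
[cite: CaolaboraEtAl2025, §1.3 p. 5, profile equations] -/
theorem logVar_solve {r u s p q : ℝ}
    (h1 : (r - 1) * u + (1 + u) * (u + p) + 1 / 3 * s * (s + q) = 0)
    (h2 : (r - 1) * s + (1 + u) * (s + q) + 1 / 3 * s * (u + p + 2 * u) = 0)
    (hΔ : (1 + u) ^ 2 - (s / 3) ^ 2 ≠ 0) :
    p = ((1 + u) * (-(r - 1) * u - (1 + u) * u - s ^ 2 / 3) -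
          s / 3 * (-(r - 1) * s - (1 + u) * s - s * u)) / ((1 + u) ^ 2 - (s / 3) ^ 2) ∧
    q = ((1 + u) * (-(r - 1) * s - (1 + u) * s - s * u) -
          s / 3 * (-(r - 1) * u - (1 + u) * u - s ^ 2 / 3)) / ((1 + u) ^ 2 - (s / 3) ^ 2) := by
  rw [eq_div_iff hΔ, eq_div_iff hΔ]
  constructor
  · linear_combination (1 + u) * h1 - s / 3 * h2
  · linear_combination (1 + u) * h2 - s / 3 * h1

/-- **Back from the logarithmic variable.** If `Φ` is smooth on `(0, ∞)` and all derivatives of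
`ξ ↦ e^{−ξ}Φ(e^ξ)` are bounded on `(a, ∞)`, then `|Φ^{(k)}(ζ)| ≤ C_k ζ^{1−k}` for `ζ > e^a`:
indeed `Φ^{(k)}(ζ) = ζ^{1−k} h_k(log ζ)` with `h₀(ξ) = e^{−ξ}Φ(e^ξ)`, `h_{k+1} = h_k′ + (1−k)h_k`.
[folklore] -/
theorem iteratedDeriv_le_rpow_of_log {Φ : ℝ → ℝ} {a : ℝ}
    (hΦ : ∀ ζ : ℝ, 0 < ζ → ContDiffAt ℝ ∞ Φ ζ)
    (hb : ∀ m : ℕ, ∃ C, ∀ ξ, a < ξ →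
      |iteratedDeriv m (fun ξ => Real.exp (-ξ) * Φ (Real.exp ξ)) ξ| ≤ C)
    (k : ℕ) : ∃ C, ∀ ζ, Real.exp a < ζ → |iteratedDeriv k Φ ζ| ≤ C * ζ ^ (1 - (k : ℝ)) := by
  -- the functions `h_k`
  have key : ∀ k : ℕ, ∃ h : ℝ → ℝ, ContDiff ℝ ∞ h ∧
      (∀ m : ℕ, ∃ C, ∀ ξ, a < ξ → |iteratedDeriv m h ξ| ≤ C) ∧
      ∀ ζ, Real.exp a < ζ → iteratedDeriv k Φ ζ = ζ ^ (1 - (k : ℝ)) * h (Real.log ζ) := by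
    intro k
    induction k with
    | zero =>
      refine ⟨fun ξ => Real.exp (-ξ) * Φ (Real.exp ξ), contDiff_logProfile hΦ, hb, fun ζ hζ => ?_⟩
      have hζ0 : 0 < ζ := (Real.exp_pos a).trans hζ
      simp only [iteratedDeriv_zero, Nat.cast_zero, sub_zero, Real.rpow_one, Real.exp_log hζ0,
        Real.exp_neg]
      field_simp
    | succ k ih =>
      obtain ⟨h, hh, hbd, hfo⟩ := ih
      have hh' : ContDiff ℝ ∞ (deriv h) := (contDiff_infty_iff_deriv.1 hh).2
      refine ⟨fun ξ => deriv h ξ + (1 - k) * h ξ,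
        hh'.add (contDiff_const.mul hh), fun m => ?_, fun ζ hζ => ?_⟩
      · -- bounds for the derivatives of `h' + (1 - k) h`
        obtain ⟨C₁, hC₁⟩ := hbd (m + 1)
        obtain ⟨C₀, hC₀⟩ := hbd m
        refine ⟨C₁ + |1 - (k : ℝ)| * C₀, fun ξ hξ => ?_⟩
        have e1 : iteratedDeriv m (fun ξ => deriv h ξ + (1 - k) * h ξ) ξ =
            iteratedDeriv (m + 1) h ξ + (1 - k) * iteratedDeriv m h ξ := by
          have ha : ContDiffAt ℝ m (deriv h) ξ := (hh'.of_le (by exact_mod_cast le_top)).contDiffAt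
          have hb' : ContDiffAt ℝ m (fun ξ => (1 - (k : ℝ)) * h ξ) ξ :=
            ((contDiff_const.mul hh).of_le (by exact_mod_cast le_top)).contDiffAt
          have := iteratedDeriv_add ha hb'
          rw [show ((deriv h) + fun ξ => (1 - (k : ℝ)) * h ξ) =
            fun ξ => deriv h ξ + (1 - k) * h ξ from rfl] at this
          rw [this, iteratedDeriv_succ', iteratedDeriv_const_mul _
            ((hh.of_le (by exact_mod_cast le_top)).contDiffAt)]
        rw [e1]
        calc |iteratedDeriv (m + 1) h ξ + (1 - ↑k) * iteratedDeriv m h ξ|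
            ≤ |iteratedDeriv (m + 1) h ξ| + |(1 - ↑k) * iteratedDeriv m h ξ| := abs_add_le _ _
          _ ≤ C₁ + |1 - (k : ℝ)| * C₀ := by
            rw [abs_mul]
            exact add_le_add (hC₁ ξ hξ) (mul_le_mul_of_nonneg_left (hC₀ ξ hξ) (abs_nonneg _))
      · -- the formula for the next derivative
        have hζ0 : 0 < ζ := (Real.exp_pos a).trans hζ
        have heq : iteratedDeriv k Φ =ᶠ[𝓝 ζ] fun η => η ^ (1 - (k : ℝ)) * h (Real.log η) := by
          filter_upwards [Ioi_mem_nhds hζ] with η hη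
          exact hfo η hη
        have d1 : HasDerivAt (fun η => η ^ (1 - (k : ℝ)))
            ((1 - (k : ℝ)) * ζ ^ (1 - (k : ℝ) - 1)) ζ := by
          simpa using Real.hasDerivAt_rpow_const (p := 1 - (k : ℝ)) (Or.inl hζ0.ne')
        have d2 : HasDerivAt (fun η => h (Real.log η)) (deriv h (Real.log ζ) * ζ⁻¹) ζ :=
          ((hh.differentiable (by simp) _).hasDerivAt).comp ζ (Real.hasDerivAt_log hζ0.ne')
        have d3 : HasDerivAt (fun η => η ^ (1 - (k : ℝ)) * h (Real.log η))
            ((1 - (k : ℝ)) * ζ ^ (1 - (k : ℝ) - 1) * h (Real.log ζ) +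
              ζ ^ (1 - (k : ℝ)) * (deriv h (Real.log ζ) * ζ⁻¹)) ζ := d1.mul d2
        rw [iteratedDeriv_succ, heq.deriv_eq, d3.deriv]
        have e2 : ζ ^ (1 - (k : ℝ)) = ζ ^ (1 - (k : ℝ) - 1) * ζ := by
          rw [Real.rpow_sub_one hζ0.ne']
          field_simp
        rw [show (1 - ((k + 1 : ℕ) : ℝ)) = 1 - (k : ℝ) - 1 by push_cast; ring, e2]
        field_simp
        ring
  obtain ⟨h, -, hbd, hfo⟩ := key k
  obtain ⟨C, hC⟩ := hbd 0
  refine ⟨C, fun ζ hζ => ?_⟩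
  have hζ0 : 0 < ζ := (Real.exp_pos a).trans hζ
  have hlog : a < Real.log ζ := (Real.lt_log_iff_exp_lt hζ0).2 hζ
  rw [hfo ζ hζ, abs_mul, abs_of_pos (Real.rpow_pos_of_pos hζ0 _), mul_comm]
  exact mul_le_mul_of_nonneg_right (by simpa using hC _ hlog) (Real.rpow_nonneg hζ0.le _)

end LogVar

/-! ### The profile: all derivatives decay like `ζ^{1−k}` -/

section Profile

variable {r : ℝ} {U S : ℝ → ℝ}

/-- **Decay of all derivatives of the self-similar profile.** For radial profiles as in the
vendored fact `BuckmasterCaolaboraGomezserrano2025_thm11_monatomic` (smooth radial fields on `ℝ³`,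
the radial profile ODEs for `ζ > 0`, end-point condition `U/ζ, S/ζ → 0`), for every `k` there are
`ζ₀ > 0` and `C` with `|U^{(k)}(ζ)| ≤ C ζ^{1−k}` and `|S^{(k)}(ζ)| ≤ C ζ^{1−k}` for all
`ζ ≥ ζ₀` — the `r`-independent weak form of the far-field asymptotics (1.6) of the source
(`|∇ʲŪ| + |∇ʲS̄| ≲ ⟨ζ⟩^{1−r−j}`), obtained from the autonomous system satisfied by
`(U/ζ, S/ζ)` in the variable `log ζ` near its equilibrium `P_∞ = (0,0)`.
[cite: CaolaboraEtAl2025, eq. (1.6) p. 6] [cite: BuckmasterCaolaboraGomezserrano2025, Thm 1.1 p. 4] -/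
theorem iteratedDeriv_profile_le (hU : ContDiff ℝ ∞ fun y : V3 => (U ‖y‖ / ‖y‖) • y)
    (hS : ContDiff ℝ ∞ fun y : V3 => S ‖y‖)
    (hode : ∀ ζ : ℝ, 0 < ζ →
      (r - 1) * U ζ + (ζ + U ζ) * deriv U ζ + 1 / 3 * S ζ * deriv S ζ = 0 ∧
      (r - 1) * S ζ + (ζ + U ζ) * deriv S ζ + 1 / 3 * S ζ * (deriv U ζ + 2 * U ζ / ζ) = 0)
    (hlimU : Tendsto (fun ζ => U ζ / ζ) atTop (𝓝 0))
    (hlimS : Tendsto (fun ζ => S ζ / ζ) atTop (𝓝 0)) (k : ℕ) :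
    ∃ ζ₀ C : ℝ, 0 < ζ₀ ∧ ∀ ζ, ζ₀ ≤ ζ →
      |iteratedDeriv k U ζ| ≤ C * ζ ^ (1 - (k : ℝ)) ∧
        |iteratedDeriv k S ζ| ≤ C * ζ ^ (1 - (k : ℝ)) := by
  have hUc : ∀ ζ : ℝ, 0 < ζ → ContDiffAt ℝ ∞ U ζ := fun ζ hζ => contDiffAt_profile_of_radialField hU hζ
  have hSc : ∀ ζ : ℝ, 0 < ζ → ContDiffAt ℝ ∞ S ζ := fun ζ hζ => contDiffAt_profile_of_radialScalar hS hζ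
  -- the unknowns in the logarithmic variable
  set 𝒰 : ℝ → ℝ := fun ξ => Real.exp (-ξ) * U (Real.exp ξ) with h𝒰
  set 𝒮 : ℝ → ℝ := fun ξ => Real.exp (-ξ) * S (Real.exp ξ) with h𝒮
  have h𝒰s : ContDiff ℝ ∞ 𝒰 := contDiff_logProfile hUc
  have h𝒮s : ContDiff ℝ ∞ 𝒮 := contDiff_logProfile hSc
  have hU𝒰 : ∀ ξ, U (Real.exp ξ) = Real.exp ξ * 𝒰 ξ := fun ξ => by
    simp only [h𝒰, Real.exp_neg]
    field_simp
  have hS𝒮 : ∀ ξ, S (Real.exp ξ) = Real.exp ξ * 𝒮 ξ := fun ξ => by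
    simp only [h𝒮, Real.exp_neg]
    field_simp
  -- they tend to the equilibrium `(0, 0)`
  have hl𝒰 : Tendsto 𝒰 atTop (𝓝 0) := by
    refine (hlimU.comp Real.tendsto_exp_atTop).congr fun ξ => ?_
    simp only [Function.comp_apply, h𝒰, Real.exp_neg, div_eq_inv_mul]
  have hl𝒮 : Tendsto 𝒮 atTop (𝓝 0) := by
    refine (hlimS.comp Real.tendsto_exp_atTop).congr fun ξ => ?_
    simp only [Function.comp_apply, h𝒮, Real.exp_neg, div_eq_inv_mul]
  obtain ⟨a, ha⟩ : ∃ a, ∀ ξ, a ≤ ξ → |𝒰 ξ| < 1 / 4 ∧ |𝒮 ξ| < 1 / 4 := by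
    have e1 := Metric.tendsto_nhds.1 hl𝒰 (1 / 4) (by norm_num)
    have e2 := Metric.tendsto_nhds.1 hl𝒮 (1 / 4) (by norm_num)
    obtain ⟨a, ha⟩ := eventually_atTop.1 (e1.and e2)
    exact ⟨a, fun ξ hξ => by simpa [Real.dist_eq] using ha ξ hξ⟩
  -- the autonomous vector field, smooth where the determinant does not vanish
  set W : ℝ × ℝ → ℝ × ℝ := fun w =>
    (((1 + w.1) * (-(r - 1) * w.1 - (1 + w.1) * w.1 - w.2 ^ 2 / 3) -
        w.2 / 3 * (-(r - 1) * w.2 - (1 + w.1) * w.2 - w.2 * w.1)) /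
        ((1 + w.1) ^ 2 - (w.2 / 3) ^ 2),
      ((1 + w.1) * (-(r - 1) * w.2 - (1 + w.1) * w.2 - w.2 * w.1) -
        w.2 / 3 * (-(r - 1) * w.1 - (1 + w.1) * w.1 - w.2 ^ 2 / 3)) /
        ((1 + w.1) ^ 2 - (w.2 / 3) ^ 2)) with hWdef
  set O : Set (ℝ × ℝ) := {w | (1 + w.1) ^ 2 - (w.2 / 3) ^ 2 ≠ 0} with hO
  have hOo : IsOpen O := isOpen_ne_fun (by fun_prop) continuous_const
  have hWs : ContDiffOn ℝ ∞ W O := by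
    have hΔ : ContDiffOn ℝ ∞ (fun w : ℝ × ℝ => (1 + w.1) ^ 2 - (w.2 / 3) ^ 2) O := by fun_prop
    have hn1 : ContDiffOn ℝ ∞ (fun w : ℝ × ℝ =>
        (1 + w.1) * (-(r - 1) * w.1 - (1 + w.1) * w.1 - w.2 ^ 2 / 3) -
          w.2 / 3 * (-(r - 1) * w.2 - (1 + w.1) * w.2 - w.2 * w.1)) O := by fun_prop
    have hn2 : ContDiffOn ℝ ∞ (fun w : ℝ × ℝ =>
        (1 + w.1) * (-(r - 1) * w.2 - (1 + w.1) * w.2 - w.2 * w.1) -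
          w.2 / 3 * (-(r - 1) * w.1 - (1 + w.1) * w.1 - w.2 ^ 2 / 3)) O := by fun_prop
    exact (hn1.div hΔ fun w hw => hw).prodMk (hn2.div hΔ fun w hw => hw)
  -- the compact neighbourhood of the equilibrium in which the orbit stays
  set K : Set (ℝ × ℝ) := Metric.closedBall 0 (1 / 4) with hK
  have hKc : IsCompact K := isCompact_closedBall _ _
  have hKO : K ⊆ O := by
    intro w hw
    have hw' : ‖w‖ ≤ 1 / 4 := by simpa [hK] using hw
    have h1 : |w.1| ≤ 1 / 4 := (norm_fst_le w).trans hw'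
    have h2 : |w.2| ≤ 1 / 4 := (norm_snd_le w).trans hw'
    rw [abs_le] at h1 h2
    show (1 + w.1) ^ 2 - (w.2 / 3) ^ 2 ≠ 0
    nlinarith
  -- the orbit
  set y : ℝ → ℝ × ℝ := fun ξ => (𝒰 ξ, 𝒮 ξ) with hy
  have hyK : ∀ ξ, a < ξ → y ξ ∈ K := by
    intro ξ hξ
    have h := ha ξ hξ.le
    simp only [hK, Metric.mem_closedBall, dist_zero_right, Prod.norm_def, hy, Real.norm_eq_abs]
    exact max_le h.1.le h.2.le
  have hyO : ∀ ξ, a < ξ → y ξ ∈ O := fun ξ hξ => hKO (hyK ξ hξ)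
  -- the orbit solves the autonomous system
  have hode' : ∀ ξ, a < ξ → HasDerivAt y (W (y ξ)) ξ := by
    intro ξ hξ
    have hΔ : (1 + 𝒰 ξ) ^ 2 - (𝒮 ξ / 3) ^ 2 ≠ 0 := hyO ξ hξ
    have d𝒰 := hasDerivAt_logProfile hUc ξ
    have d𝒮 := hasDerivAt_logProfile hSc ξ
    set p : ℝ := -(Real.exp (-ξ) * U (Real.exp ξ)) + deriv U (Real.exp ξ) with hp
    set q : ℝ := -(Real.exp (-ξ) * S (Real.exp ξ)) + deriv S (Real.exp ξ) with hq
    have hUp : deriv U (Real.exp ξ) = 𝒰 ξ + p := by simp only [hp, h𝒰]; ring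
    have hSq : deriv S (Real.exp ξ) = 𝒮 ξ + q := by simp only [hq, h𝒮]; ring
    have hζ := Real.exp_pos ξ
    obtain ⟨E1, E2⟩ := hode _ hζ
    rw [hU𝒰, hS𝒮, hUp, hSq] at E1 E2
    have hdiv : 2 * (Real.exp ξ * 𝒰 ξ) / Real.exp ξ = 2 * 𝒰 ξ := by field_simp
    rw [hdiv] at E2
    have L1 : (r - 1) * 𝒰 ξ + (1 + 𝒰 ξ) * (𝒰 ξ + p) + 1 / 3 * 𝒮 ξ * (𝒮 ξ + q) = 0 := by
      have h0 : Real.exp ξ * ((r - 1) * 𝒰 ξ + (1 + 𝒰 ξ) * (𝒰 ξ + p) +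
          1 / 3 * 𝒮 ξ * (𝒮 ξ + q)) = 0 := by rw [← E1]; ring
      exact (mul_eq_zero.1 h0).resolve_left hζ.ne'
    have L2 : (r - 1) * 𝒮 ξ + (1 + 𝒰 ξ) * (𝒮 ξ + q) +
        1 / 3 * 𝒮 ξ * (𝒰 ξ + p + 2 * 𝒰 ξ) = 0 := by
      have h0 : Real.exp ξ * ((r - 1) * 𝒮 ξ + (1 + 𝒰 ξ) * (𝒮 ξ + q) +
          1 / 3 * 𝒮 ξ * (𝒰 ξ + p + 2 * 𝒰 ξ)) = 0 := by rw [← E2]; ring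
      exact (mul_eq_zero.1 h0).resolve_left hζ.ne'
    obtain ⟨hp', hq'⟩ := logVar_solve L1 L2 hΔ
    have hW : W (y ξ) = (p, q) := by
      simp only [hWdef, hy]
      rw [hp', hq']
    rw [hW]
    exact d𝒰.prodMk d𝒮
  -- hence all derivatives of `(𝒰, 𝒮)` are bounded on `(a, ∞)`
  have hb : ∀ m : ℕ, ∃ C, ∀ ξ, a < ξ → |iteratedDeriv m 𝒰 ξ| ≤ C ∧ |iteratedDeriv m 𝒮 ξ| ≤ C := by
    intro m
    obtain ⟨C, hC⟩ := exists_bound_iteratedDeriv_of_flow hOo hWs hKc hKO hode' hyK m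
    refine ⟨C, fun ξ hξ => ?_⟩
    have h := hC ξ hξ
    rw [hy, iteratedDeriv_prodMk h𝒰s h𝒮s m] at h
    simp only [Prod.norm_def, Real.norm_eq_abs, max_le_iff] at h
    exact h
  -- back to `ζ`
  obtain ⟨CU, hCU⟩ := iteratedDeriv_le_rpow_of_log hUc (fun m => (hb m).imp fun C hC ξ hξ => (hC ξ hξ).1) k
  obtain ⟨CS, hCS⟩ := iteratedDeriv_le_rpow_of_log hSc (fun m => (hb m).imp fun C hC ξ hξ => (hC ξ hξ).2) k
  refine ⟨Real.exp a + 1, max CU CS, by positivity, fun ζ hζ => ?_⟩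
  have hζ' : Real.exp a < ζ := by linarith
  have hζ0 : 0 < ζ := (Real.exp_pos a).trans hζ'
  have hpow : 0 ≤ ζ ^ (1 - (k : ℝ)) := Real.rpow_nonneg hζ0.le _
  exact ⟨(hCU ζ hζ').trans (mul_le_mul_of_nonneg_right (le_max_left _ _) hpow),
    (hCS ζ hζ').trans (mul_le_mul_of_nonneg_right (le_max_right _ _) hpow)⟩

end Profile

end CaolaboraEtAl2025

end Literature.Analysis.FluidPDE
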